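import Summits.HodgeConjecture.CorCM.MultiFieldWeilPairAdditiveTools
import HarnessLib

/-!
# MULTI-FIELD WEIL ENGINE, census — BLOCK ADDITIVITY WITH ADDITIVE EXCEPTIONAL PAIRS: the slot criterion across blocks may fail on cross pairs
# of slots whose PAIR sub-family is jointly onto (e.g. nondegenerate), provided each such slot meets no third slot

Cell `pub-hodgecm2` (COR-CM), seat b30 gen 36 (2026-08-25); count-neutral own lane MULTI-FIELD WEIL ENGINE (stem `MultiFieldWeil*`).  Abstract setting of
`Literature/NumberTheory/ComplexMultiplication/CMTypeRankPartitionSlots` (seat p2 ∕ b16): a group `G` acting on finite sets `E_i`, types `Φ_i ⊆ E_i` that are CM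
types for one `ρ ∈ G`, the family type `Σ = sigmaType Φ ⊆ ⊔_i E_i`, the antisymmetric spans `U(Φ_i) = antiSpan G Φ_i`, `U(Σ)`, the ranks `typeRank`
(`= dim MT`), and a partition `κ : I ↠ C` of the slots into blocks.  Theorems only; no definition, no named fact, no `sorry`.  Nothing Hodge-theoretic is
asserted here and `HC_CM` is NOT touched.

THE SLOT CRITERION (`typeRank_sigmaType_add_card_eq_of_pairwise_slots_fiber`, p2 ∕ b16) gives block additivity `rank(Σ) + |C| = Σ_c rank(Σ|_c) + 1`
(`Hg(∏_i A_i) = ∏_c Hg(∏_{κ i = c} A_i)`) when NO two slots of different blocks share a constituent.  It is sufficient, not necessary: two simple CM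
threefolds `T ⊨ (k·F; Φ)`, `T' ⊨ (k'·F; Φ')` over the two imaginary quadratic fields `k ≠ k'` of one Galois closure `k·L_F` ("sisters") share the
constituent `χ_k ⊗ std_F ≅ χ_{k'} ⊗ std_F`, yet `Hg(T × T') = Hg(T) × Hg(T')` (the pair is nondegenerate: no common imaginary quadratic field) — the two
coefficient vectors of the shared constituent are not proportional.

**THEOREM (`typeRank_sigmaType_add_card_eq_of_pairwise_or_jointly_onto_fiber`).**  Block additivity holds if for every ordered cross pair of slots `i, j`
(`κ i ≠ κ j`) EITHER `U(Φ_i)`, `U(Φ_j)` have no common constituent (p2's predicate: no non-zero stable `P ≤ U(Φ_i)` maps equivariantly and injectively into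
`U(Φ_j)`), OR (a) the pair is JOINTLY ONTO — for all `a ∈ U(Φ_i)`, `b ∈ U(Φ_j)` some `m ∈ U(Σ)` restricts to `a` on the slot `i` and to `b` on the slot `j`
(equivalently `U(Σ|_{{i,j}}) = U(Φ_i) × U(Φ_j)`; it holds when the pair sub-family is nondegenerate, `jointlyOnto_of_typeRank_pair_eq`) — AND (b) every
third slot `l ∉ {i, j}` (of any block) has no common constituent with `U(Φ_i)` or none with `U(Φ_j)`.

PROOF (p2's orthogonality argument with a finer support analysis).  `M = U(Σ) ≤ U = ⊕_c U(Σ|_c)`; if `M < U`, the stable `C = U ∩ M^⊥` is non-zero and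
contains a minimal non-zero stable `P`; every INNER slot restriction is zero or injective on `P`; two injective inner slots in different blocks carry the
common constituent `P`, so by the hypothesis they form a jointly-onto pair `(i, j)` and, by (b), NO third inner slot is injective: a non-zero `f ∈ P` is
supported on `{i, j}`, and (a) gives `m ∈ M` with the same two restrictions, whence `0 = ⟨m, f⟩ = |f_i|² + |f_j|² > 0`.  If all injective inner slots lie in
one block `c`, `f` is supported on the block `c` and `m ∈ M` with `m|_c = f|_c` gives `0 = ⟨m, f⟩ = |f|_c|² > 0` (p2's case).  (The ambient theorems are p2's.)

* Tools (invariant dot product, minimal stable subspaces, a common constituent from two injective restrictions, the regrouping transport, restriction to a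
  sub-family, `jointlyOnto_of_typeRank_pair_eq`): `CorCM/MultiFieldWeilPairAdditiveTools.lean`.
* **`map_slotExt_antiSpan_fiber_le_of_pairwise_or_jointly_onto`** (the core: `ext_c U(Σ|_c) ≤ U(⊔_c Σ|_c)`), `finrank_antiSpan_sigmaType_fiber_eq_of_pairwise_or_jointly_onto`,
  **`typeRank_sigmaType_add_card_eq_of_pairwise_or_jointly_onto_fiber`**.

[cite: Gordon1999HodgeAVSurvey, §3 Theorem (Imai, Murty) (proof), 7.5–7.7] [cite: MoonenZarhin1999LowDim, §3 (3.1), Remark (3.9)] [cite: Serre1977, §1.3, §2.2 Prop. 4]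
[cite: Deligne1982HodgeCycles, I Ex. 3.7 (c)]

## References
* [Gordon1999HodgeAVSurvey] B. B. Gordon, *A survey of the Hodge conjecture for abelian varieties*, §3 Theorem with proof; 7.5–7.7.
* [MoonenZarhin1999LowDim] B. Moonen, Yu. Zarhin, Math. Ann. 315 (1999) 711–733, §3 (3.1), (3.9).
* [Serre1977] J.-P. Serre, *Linear Representations of Finite Groups*, GTM 42, §1.3, §2.2.  [Deligne1982HodgeCycles] P. Deligne, LNM 900 (1982), I Ex. 3.7.
-/

set_option autoImplicit false

noncomputable section

open scoped BigOperators

namespace Summit.HodgeConjecture.CorCM.MultiFieldWeil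

open Literature.NumberTheory.ComplexMultiplication

universe u v w

variable {G : Type w} [Group G] {I : Type u} {E : I → Type v} [∀ i, MulAction G (E i)] {C : Type u}

/-! ## The core and the rank statements -/

section Core

variable [Fintype I] [Fintype C] [DecidableEq C] [∀ i, Fintype (E i)]

/-- **THE CORE: `ext_c U(Σ|_c) ≤ U(⊔_c Σ|_c)` under «no common constituent, or jointly onto and isolated» across blocks.**  For every ordered cross pair
`i, j` (`κ i ≠ κ j`): either `U(Φ_i)`, `U(Φ_j)` have no common constituent, or the pair is jointly onto in `U(Σ)` and every third slot has no common
constituent with `U(Φ_i)` or with `U(Φ_j)`.  Then the weights of `U(Σ|_c)` extended by zero lie in `U(⊔_c Σ|_c)`.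
[cite: Gordon1999HodgeAVSurvey, §3 Theorem (proof)] [cite: Serre1977, §2.2 Prop. 4 (proof)] -/
theorem map_slotExt_antiSpan_fiber_le_of_pairwise_or_jointly_onto {Φ : ∀ i, Set (E i)} (κ : I → C)
    (hyp : ∀ i j, κ i ≠ κ j →
      (∀ P : Submodule ℚ (E i → ℚ), P ≤ antiSpan G (Φ i) → (∀ g : G, ∀ f ∈ P, (fun x => f (g • x)) ∈ P) →
        ∀ T : (E i → ℚ) →ₗ[ℚ] (E j → ℚ), (∀ g : G, ∀ f ∈ P, T (fun x => f (g • x)) = fun y => T f (g • y)) →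
          (∀ f ∈ P, T f ∈ antiSpan G (Φ j)) → (∀ f ∈ P, T f = 0 → f = 0) → P = ⊥) ∨
      ((∀ a ∈ antiSpan G (Φ i), ∀ b ∈ antiSpan G (Φ j), ∃ m ∈ antiSpan G (sigmaType Φ),
          LinearMap.funLeft ℚ ℚ (Sigma.mk i) m = a ∧ LinearMap.funLeft ℚ ℚ (Sigma.mk j) m = b) ∧
        ∀ l, l ≠ i → l ≠ j →
          (∀ P : Submodule ℚ (E i → ℚ), P ≤ antiSpan G (Φ i) → (∀ g : G, ∀ f ∈ P, (fun x => f (g • x)) ∈ P) →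
            ∀ T : (E i → ℚ) →ₗ[ℚ] (E l → ℚ), (∀ g : G, ∀ f ∈ P, T (fun x => f (g • x)) = fun y => T f (g • y)) →
              (∀ f ∈ P, T f ∈ antiSpan G (Φ l)) → (∀ f ∈ P, T f = 0 → f = 0) → P = ⊥) ∨
          (∀ P : Submodule ℚ (E j → ℚ), P ≤ antiSpan G (Φ j) → (∀ g : G, ∀ f ∈ P, (fun x => f (g • x)) ∈ P) →
            ∀ T : (E j → ℚ) →ₗ[ℚ] (E l → ℚ), (∀ g : G, ∀ f ∈ P, T (fun x => f (g • x)) = fun y => T f (g • y)) →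
              (∀ f ∈ P, T f ∈ antiSpan G (Φ l)) → (∀ f ∈ P, T f = 0 → f = 0) → P = ⊥)))
    (c₀ : C) :
    (antiSpan G (sigmaType fun i : {i // κ i = c₀} => Φ i.1)).map (slotExt c₀) ≤
      antiSpan G (sigmaType fun c => sigmaType fun i : {i // κ i = c} => Φ i.1) := by
  classical
  -- outer slots `E' c = ⊔_{κ i = c} E_i`, outer restrictions `p c`, inner restrictions `q c i`
  set Ψ : ∀ c : C, Set (Σ i : {i // κ i = c}, E i.1) := fun c => sigmaType fun i : {i // κ i = c} => Φ i.1 with hΨ_def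
  set p : ∀ c : C, ((Σ c, Σ i : {i // κ i = c}, E i.1) → ℚ) →ₗ[ℚ] ((Σ i : {i // κ i = c}, E i.1) → ℚ) :=
    fun c => LinearMap.funLeft ℚ ℚ (@Sigma.mk C (fun c' => Σ i : {i // κ i = c'}, E i.1) c) with hp_def
  set q : ∀ (c : C) (i : {i // κ i = c}), ((Σ i : {i // κ i = c}, E i.1) → ℚ) →ₗ[ℚ] (E i.1 → ℚ) :=
    fun c i => LinearMap.funLeft ℚ ℚ (@Sigma.mk _ (fun i' : {i // κ i = c} => E i'.1) i) with hq_def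
  have hpg : ∀ (c) (f : (Σ c, Σ i : {i // κ i = c}, E i.1) → ℚ) (g : G), p c (fun x => f (g • x)) = fun s => p c f (g • s) := fun _ _ _ => rfl
  have hqg : ∀ (c i) (f : (Σ i : {i // κ i = c}, E i.1) → ℚ) (g : G), q c i (fun x => f (g • x)) = fun s => q c i f (g • s) := fun _ _ _ _ => rfl
  have hpqg : ∀ (c i) (f : (Σ c, Σ i : {i // κ i = c}, E i.1) → ℚ) (g : G), (q c i ∘ₗ p c) (fun x => f (g • x)) = fun s => (q c i ∘ₗ p c) f (g • s) :=
    fun _ _ _ _ => rfl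
  set M : Submodule ℚ ((Σ c, Σ i : {i // κ i = c}, E i.1) → ℚ) := antiSpan G (sigmaType Ψ) with hM_def
  set U : Submodule ℚ ((Σ c, Σ i : {i // κ i = c}, E i.1) → ℚ) := ⨅ c, (antiSpan G (Ψ c)).comap (p c) with hU_def
  have hpU : ∀ c, ∀ f ∈ U, p c f ∈ antiSpan G (Ψ c) := fun c f hf => Submodule.mem_comap.1 ((Submodule.mem_iInf _).1 hf c)
  have hpM' : ∀ c, ∀ a ∈ antiSpan G (Ψ c), ∃ m ∈ M, p c m = a := fun c a ha => by
    rw [← map_funLeft_mk_antiSpan_sigmaType Ψ c] at ha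
    obtain ⟨m, hm, rfl⟩ := ha
    exact ⟨m, hm, rfl⟩
  have hpM : ∀ c, ∀ f ∈ M, p c f ∈ antiSpan G (Ψ c) := fun c f hf => by
    rw [← map_funLeft_mk_antiSpan_sigmaType Ψ c]
    exact ⟨f, hf, rfl⟩
  have hqU' : ∀ c i, ∀ a ∈ antiSpan G (Ψ c), q c i a ∈ antiSpan G (Φ i.1) := fun c i a ha => by
    rw [← map_funLeft_mk_antiSpan_sigmaType (fun i : {i // κ i = c} => Φ i.1) i]
    exact ⟨a, ha, rfl⟩
  have hMU : M ≤ U := fun f hf => (Submodule.mem_iInf _).2 fun c => Submodule.mem_comap.2 (hpM c f hf)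
  have hMst : ∀ g : G, ∀ f ∈ M, (fun x => f (g • x)) ∈ M := fun g f hf => comp_smul_mem_antiSpan hf g
  have hUst : ∀ g : G, ∀ f ∈ U, (fun x => f (g • x)) ∈ U := fun g f hf =>
    (Submodule.mem_iInf _).2 fun c => Submodule.mem_comap.2 (by rw [hpg]; exact comp_smul_mem_antiSpan (hpU c f hf) g)
  -- suppose the conclusion fails: then `M < U`
  by_contra hnot
  have hlt : M < U := by
    refine lt_of_le_of_ne hMU fun hMU' => hnot ?_
    rintro _ ⟨a, ha, rfl⟩
    rw [hMU']
    refine (Submodule.mem_iInf _).2 fun c => Submodule.mem_comap.2 ?_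
    by_cases hc : c = c₀
    · subst hc
      have e : p c (slotExt c a) = a := by
        funext s
        simp only [hp_def, LinearMap.funLeft_apply, slotExt_apply_same]
      rw [e]; exact ha
    · have e : p c (slotExt c₀ a) = 0 := by
        funext s
        simp only [hp_def, LinearMap.funLeft_apply, slotExt_apply_of_ne hc, Pi.zero_apply]
      rw [e]; exact Submodule.zero_mem _
  -- the stable subspace `C' = U ⊓ M^⊥` is non-zero; a minimal stable `P ≤ C'`
  set C' : Submodule ℚ ((Σ c, Σ i : {i // κ i = c}, E i.1) → ℚ) := U ⊓ LinearMap.BilinForm.orthogonal (dotProductBilin ℚ ℚ) M with hC_def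
  have hCst : ∀ g : G, ∀ f ∈ C', (fun x => f (g • x)) ∈ C' := fun g f hf => ⟨hUst g f hf.1, PointwiseConj.comp_smul_mem_orthogonal hMst hf.2 g⟩
  have hC0 : C' ≠ ⊥ := by
    intro hC0
    have h1 := Submodule.finrank_sup_add_finrank_inf_eq U (LinearMap.BilinForm.orthogonal (dotProductBilin ℚ ℚ) M)
    have h2 := LinearMap.BilinForm.finrank_orthogonal (nondegenerate_dotProductBilin_rat (X := Σ c, Σ i : {i // κ i = c}, E i.1)) M
    have h3 := Submodule.finrank_lt_finrank_of_lt hlt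
    have h4 := Submodule.finrank_le (U ⊔ LinearMap.BilinForm.orthogonal (dotProductBilin ℚ ℚ) M)
    have h5 := Submodule.finrank_le M
    rw [← hC_def, hC0, finrank_bot] at h1
    omega
  obtain ⟨P, hPC, hP0, hPst, hPmin⟩ := exists_minimal_stable_submodule (G := G) hC0 hCst
  have hPU : P ≤ U := hPC.trans inf_le_left
  have hqpU : ∀ c i, ∀ f ∈ P, (q c i ∘ₗ p c) f ∈ antiSpan G (Φ i.1) := fun c i f hf => hqU' c i _ (hpU c f (hPU hf))
  -- inner restrictions are zero or injective on `P`
  have hdich : ∀ c i, (∀ f ∈ P, (q c i ∘ₗ p c) f = 0) ∨ ∀ f ∈ P, (q c i ∘ₗ p c) f = 0 → f = 0 :=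
    fun c i => forall_eq_zero_or_injOn_of_minimal_stable (G := G) hPst hPmin (q c i ∘ₗ p c) (fun g f _ => hpqg c i f g)
  -- two non-zero inner restrictions at slots `i.1 ≠ i'.1` exhibit a common constituent of `U(Φ_{i.1})`, `U(Φ_{i'.1})`
  have hcommon : ∀ (c : C) (i : {i // κ i = c}) (c' : C) (i' : {i // κ i = c'}), (¬ ∀ f ∈ P, (q c i ∘ₗ p c) f = 0) → (¬ ∀ f ∈ P, (q c' i' ∘ₗ p c') f = 0) →
      ¬ ∀ Q : Submodule ℚ (E i.1 → ℚ), Q ≤ antiSpan G (Φ i.1) → (∀ g : G, ∀ f ∈ Q, (fun x => f (g • x)) ∈ Q) →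
        ∀ T : (E i.1 → ℚ) →ₗ[ℚ] (E i'.1 → ℚ), (∀ g : G, ∀ f ∈ Q, T (fun x => f (g • x)) = fun y => T f (g • y)) →
          (∀ f ∈ Q, T f ∈ antiSpan G (Φ i'.1)) → (∀ f ∈ Q, T f = 0 → f = 0) → Q = ⊥ := by
    intro c i c' i' hi hi'
    exact not_pairwise_of_two_injOn (G := G) hP0 hPst (q c i ∘ₗ p c) (q c' i' ∘ₗ p c') (fun g f _ => hpqg c i f g) (fun g f _ => hpqg c' i' f g)
      ((hdich c i).resolve_left hi) ((hdich c' i').resolve_left hi') (hqpU c i) (hqpU c' i')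
  -- a non-zero `f₀ ∈ P` and a non-zero inner restriction `(c₁, i₁)`
  obtain ⟨f₀, hf₀, hf₀0⟩ := (Submodule.ne_bot_iff P).1 hP0
  have horth : ∀ m ∈ M, m ⬝ᵥ f₀ = 0 := fun m hm => by
    have h2 := LinearMap.BilinForm.mem_orthogonal_iff.1 (hPC hf₀).2 m hm
    simpa only [dotProductBilin, LinearMap.coe_mk, AddHom.coe_mk] using h2
  -- the dot product, slot by slot and then inner slot by inner slot
  have hdot : ∀ m : (Σ c, Σ i : {i // κ i = c}, E i.1) → ℚ, m ⬝ᵥ f₀ = ∑ c, ∑ i : {i // κ i = c}, (q c i ∘ₗ p c) m ⬝ᵥ (q c i ∘ₗ p c) f₀ := fun m => by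
    simp only [dotProduct, LinearMap.comp_apply, LinearMap.funLeft_apply, hq_def, hp_def]
    rw [Fintype.sum_sigma]
    exact Finset.sum_congr rfl fun c _ => Fintype.sum_sigma _
  have hex : ∃ c, ∃ i : {i // κ i = c}, ¬ ∀ f ∈ P, (q c i ∘ₗ p c) f = 0 := by
    by_contra hall
    push Not at hall
    apply hf₀0
    funext x
    obtain ⟨c, i, s⟩ := x
    exact congrFun (hall c i f₀ hf₀) s
  obtain ⟨c₁, i₁, hi₁⟩ := hex
  by_cases htwo : ∃ c₂, ∃ i₂ : {i // κ i = c₂}, c₂ ≠ c₁ ∧ ¬ ∀ f ∈ P, (q c₂ i₂ ∘ₗ p c₂) f = 0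
  · -- two blocks: the cross pair `(i₁, i₂)` is jointly onto and isolated
    obtain ⟨c₂, i₂, hc₂₁, hi₂⟩ := htwo
    have hκ : κ i₁.1 ≠ κ i₂.1 := by rw [i₁.2, i₂.2]; exact hc₂₁.symm
    obtain hpw | ⟨honto, hiso⟩ := hyp i₁.1 i₂.1 hκ
    · exact absurd hpw (hcommon c₁ i₁ c₂ i₂ hi₁ hi₂)
    -- every third inner slot restriction vanishes on `P`
    have hvan : ∀ c (i : {i // κ i = c}), i.1 ≠ i₁.1 → i.1 ≠ i₂.1 → ∀ f ∈ P, (q c i ∘ₗ p c) f = 0 := by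
      intro c i h₁ h₂
      by_contra hne
      rcases hiso i.1 h₁ h₂ with h | h
      · exact hcommon c₁ i₁ c i hi₁ hne h
      · exact hcommon c₂ i₂ c i hi₂ hne h
    -- the jointly-onto pair supplies `m ∈ U(Σ)` with the two restrictions of `f₀`
    obtain ⟨m, hm, hmi, hmj⟩ := honto _ (hqpU c₁ i₁ f₀ hf₀) _ (hqpU c₂ i₂ f₀ hf₀)
    set m' : (Σ c, Σ i : {i // κ i = c}, E i.1) → ℚ := LinearMap.funLeft ℚ ℚ (fun x : (Σ c, Σ i : {i // κ i = c}, E i.1) => (⟨x.2.1.1, x.2.2⟩ : Σ i, E i)) m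
      with hm'_def
    have hm'M : m' ∈ M := by
      rw [hM_def, hΨ_def, ← map_funLeft_regroup_antiSpan_sigmaType Φ κ]
      exact ⟨m, hm, rfl⟩
    have hm'q : ∀ c (i : {i // κ i = c}), (q c i ∘ₗ p c) m' = LinearMap.funLeft ℚ ℚ (Sigma.mk i.1) m := fun c i => rfl
    -- `⟨m', f₀⟩ = |f₀|_{i₁}|² + |f₀|_{i₂}|²`
    have hsum : m' ⬝ᵥ f₀ = (q c₁ i₁ ∘ₗ p c₁) f₀ ⬝ᵥ (q c₁ i₁ ∘ₗ p c₁) f₀ + (q c₂ i₂ ∘ₗ p c₂) f₀ ⬝ᵥ (q c₂ i₂ ∘ₗ p c₂) f₀ := by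
      rw [hdot]
      -- only the terms `(c₁, i₁)` and `(c₂, i₂)` survive
      have hterm : ∀ c (i : {i // κ i = c}), (q c i ∘ₗ p c) m' ⬝ᵥ (q c i ∘ₗ p c) f₀ =
          (if h : c = c₁ ∧ HEq i i₁ then (q c₁ i₁ ∘ₗ p c₁) f₀ ⬝ᵥ (q c₁ i₁ ∘ₗ p c₁) f₀ else 0) +
          (if h : c = c₂ ∧ HEq i i₂ then (q c₂ i₂ ∘ₗ p c₂) f₀ ⬝ᵥ (q c₂ i₂ ∘ₗ p c₂) f₀ else 0) := by
        intro c i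
        by_cases h1 : c = c₁ ∧ HEq i i₁
        · obtain ⟨rfl, hi⟩ := h1
          have hi' : i = i₁ := eq_of_heq hi
          subst hi'
          have h2 : ¬ (c = c₂ ∧ HEq i i₂) := fun h => hc₂₁ h.1.symm
          rw [dif_pos ⟨rfl, HEq.rfl⟩, dif_neg h2, add_zero, hm'q, hmi]
        by_cases h2 : c = c₂ ∧ HEq i i₂
        · obtain ⟨rfl, hi⟩ := h2
          have hi' : i = i₂ := eq_of_heq hi
          subst hi'
          rw [dif_neg h1, dif_pos ⟨rfl, HEq.rfl⟩, zero_add, hm'q, hmj]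
        · have hne₁ : i.1 ≠ i₁.1 := by
            intro h
            apply h1
            have hc : c = c₁ := by rw [← i.2, ← i₁.2, h]
            subst hc
            exact ⟨rfl, heq_of_eq (Subtype.ext h)⟩
          have hne₂ : i.1 ≠ i₂.1 := by
            intro h
            apply h2
            have hc : c = c₂ := by rw [← i.2, ← i₂.2, h]
            subst hc
            exact ⟨rfl, heq_of_eq (Subtype.ext h)⟩
          rw [dif_neg h1, dif_neg h2, add_zero, hvan c i hne₁ hne₂ f₀ hf₀, dotProduct_zero]
      simp_rw [hterm, Finset.sum_add_distrib]
      congr 1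
      · rw [Finset.sum_eq_single c₁, Finset.sum_eq_single i₁, dif_pos ⟨rfl, HEq.rfl⟩]
        · intro i _ hi; rw [dif_neg]; rintro ⟨-, h⟩; exact hi (eq_of_heq h)
        · intro h; exact absurd (Finset.mem_univ _) h
        · intro c _ hc; exact Finset.sum_eq_zero fun i _ => by rw [dif_neg]; rintro ⟨h, -⟩; exact hc h
        · intro h; exact absurd (Finset.mem_univ _) h
      · rw [Finset.sum_eq_single c₂, Finset.sum_eq_single i₂, dif_pos ⟨rfl, HEq.rfl⟩]
        · intro i _ hi; rw [dif_neg]; rintro ⟨-, h⟩; exact hi (eq_of_heq h)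
        · intro h; exact absurd (Finset.mem_univ _) h
        · intro c _ hc; exact Finset.sum_eq_zero fun i _ => by rw [dif_neg]; rintro ⟨h, -⟩; exact hc h
        · intro h; exact absurd (Finset.mem_univ _) h
    have h0 := horth m' hm'M
    rw [hsum] at h0
    have hnn₁ : 0 ≤ (q c₁ i₁ ∘ₗ p c₁) f₀ ⬝ᵥ (q c₁ i₁ ∘ₗ p c₁) f₀ := Finset.sum_nonneg fun x _ => mul_self_nonneg _
    have hnn₂ : 0 ≤ (q c₂ i₂ ∘ₗ p c₂) f₀ ⬝ᵥ (q c₂ i₂ ∘ₗ p c₂) f₀ := Finset.sum_nonneg fun x _ => mul_self_nonneg _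
    have hz₁ : (q c₁ i₁ ∘ₗ p c₁) f₀ ⬝ᵥ (q c₁ i₁ ∘ₗ p c₁) f₀ = 0 := by linarith
    have hinj₁ := (hdich c₁ i₁).resolve_left hi₁
    exact hf₀0 (hinj₁ f₀ hf₀ (dotProduct_self_eq_zero.1 hz₁))
  · -- one block: `f₀` is supported on the outer slot `c₁` (p2's case)
    push Not at htwo
    have hvan : ∀ c, c ≠ c₁ → p c f₀ = 0 := fun c hc => by
      funext x
      obtain ⟨i, s⟩ := x
      exact congrFun (htwo c i hc f₀ hf₀) s
    obtain ⟨m, hmM, hm⟩ := hpM' c₁ (p c₁ f₀) (hpU c₁ f₀ (hPU hf₀))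
    have h0 := horth m hmM
    have hsum : m ⬝ᵥ f₀ = p c₁ f₀ ⬝ᵥ p c₁ f₀ := by
      have hdot' : ∀ m' : (Σ c, Σ i : {i // κ i = c}, E i.1) → ℚ, m' ⬝ᵥ f₀ = ∑ c, p c m' ⬝ᵥ p c f₀ := fun m' => by
        simp only [dotProduct, LinearMap.funLeft_apply, hp_def]
        rw [Fintype.sum_sigma]
      rw [hdot', Finset.sum_eq_single c₁]
      · rw [hm]
      · intro c _ hc; rw [hvan c hc, dotProduct_zero]
      · intro h; exact absurd (Finset.mem_univ _) h
    rw [hsum] at h0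
    have hp0 : p c₁ f₀ = 0 := dotProduct_self_eq_zero.1 h0
    apply hf₀0
    funext x
    obtain ⟨c, i, s⟩ := x
    by_cases hc : c = c₁
    · subst hc; exact congrFun hp0 ⟨i, s⟩
    · exact congrFun (hvan c hc) ⟨i, s⟩


/-- **`dim U(⊔_c Σ|_c) = Σ_c dim U(Σ|_c)`** under «no common constituent, or jointly onto and isolated» across blocks (`rank Hg(∏_i A_i) = Σ_c rank Hg(∏_{κ i = c} A_i)`).
[cite: Gordon1999HodgeAVSurvey, §3 Theorem (1)] [cite: MoonenZarhin1999LowDim, §3 (3.1)] -/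
theorem finrank_antiSpan_sigmaType_fiber_eq_of_pairwise_or_jointly_onto {Φ : ∀ i, Set (E i)} (κ : I → C)
    (hyp : ∀ i j, κ i ≠ κ j →
      (∀ P : Submodule ℚ (E i → ℚ), P ≤ antiSpan G (Φ i) → (∀ g : G, ∀ f ∈ P, (fun x => f (g • x)) ∈ P) →
        ∀ T : (E i → ℚ) →ₗ[ℚ] (E j → ℚ), (∀ g : G, ∀ f ∈ P, T (fun x => f (g • x)) = fun y => T f (g • y)) →
          (∀ f ∈ P, T f ∈ antiSpan G (Φ j)) → (∀ f ∈ P, T f = 0 → f = 0) → P = ⊥) ∨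
      ((∀ a ∈ antiSpan G (Φ i), ∀ b ∈ antiSpan G (Φ j), ∃ m ∈ antiSpan G (sigmaType Φ),
          LinearMap.funLeft ℚ ℚ (Sigma.mk i) m = a ∧ LinearMap.funLeft ℚ ℚ (Sigma.mk j) m = b) ∧
        ∀ l, l ≠ i → l ≠ j →
          (∀ P : Submodule ℚ (E i → ℚ), P ≤ antiSpan G (Φ i) → (∀ g : G, ∀ f ∈ P, (fun x => f (g • x)) ∈ P) →
            ∀ T : (E i → ℚ) →ₗ[ℚ] (E l → ℚ), (∀ g : G, ∀ f ∈ P, T (fun x => f (g • x)) = fun y => T f (g • y)) →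
              (∀ f ∈ P, T f ∈ antiSpan G (Φ l)) → (∀ f ∈ P, T f = 0 → f = 0) → P = ⊥) ∨
          (∀ P : Submodule ℚ (E j → ℚ), P ≤ antiSpan G (Φ j) → (∀ g : G, ∀ f ∈ P, (fun x => f (g • x)) ∈ P) →
            ∀ T : (E j → ℚ) →ₗ[ℚ] (E l → ℚ), (∀ g : G, ∀ f ∈ P, T (fun x => f (g • x)) = fun y => T f (g • y)) →
              (∀ f ∈ P, T f ∈ antiSpan G (Φ l)) → (∀ f ∈ P, T f = 0 → f = 0) → P = ⊥))) :
    Module.finrank ℚ (antiSpan G (sigmaType fun c => sigmaType fun i : {i // κ i = c} => Φ i.1)) =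
      ∑ c, Module.finrank ℚ (antiSpan G (sigmaType fun i : {i // κ i = c} => Φ i.1)) := by
  classical
  set Ψ : ∀ c : C, Set (Σ i : {i // κ i = c}, E i.1) := fun c => sigmaType fun i : {i // κ i = c} => Φ i.1 with hΨ_def
  refine le_antisymm (finrank_antiSpan_sigmaType_le Ψ) ?_
  have hrange : LinearMap.range (sigmaLift ∘ₗ LinearMap.pi fun c => (antiSpan G (Ψ c)).subtype ∘ₗ LinearMap.proj c) ≤ antiSpan G (sigmaType Ψ) := by
    rintro _ ⟨a, rfl⟩
    change sigmaLift (fun c => (a c : (Σ i : {i // κ i = c}, E i.1) → ℚ)) ∈ _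
    rw [sigmaLift_eq_sum_slotExt]
    exact Submodule.sum_mem _ fun c _ =>
      map_slotExt_antiSpan_fiber_le_of_pairwise_or_jointly_onto κ hyp c ⟨(a c : (Σ i : {i // κ i = c}, E i.1) → ℚ), (a c).2, rfl⟩
  have hinj : Function.Injective (sigmaLift ∘ₗ LinearMap.pi fun c => (antiSpan G (Ψ c)).subtype ∘ₗ LinearMap.proj c) := by
    intro a b hab
    funext c
    apply Subtype.ext
    funext s
    exact congrFun hab ⟨c, s⟩
  calc ∑ c, Module.finrank ℚ (antiSpan G (Ψ c))
      = Module.finrank ℚ (∀ c, antiSpan G (Ψ c)) := (Module.finrank_pi_fintype ℚ).symm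
    _ = Module.finrank ℚ (LinearMap.range (sigmaLift ∘ₗ LinearMap.pi fun c => (antiSpan G (Ψ c)).subtype ∘ₗ LinearMap.proj c)) :=
        (LinearMap.finrank_range_of_inj hinj).symm
    _ ≤ Module.finrank ℚ (antiSpan G (sigmaType Ψ)) := Submodule.finrank_mono hrange

variable [Nonempty I] [∀ i, Nonempty (E i)]

/-- **BLOCK ADDITIVITY WITH ADDITIVE EXCEPTIONAL PAIRS: `rank(Σ) + |C| = Σ_c rank(Σ|_c) + 1`** — `Hg(∏_i A_i) = ∏_c Hg(∏_{κ i = c} A_i)` — for a surjection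
`κ : I → C` such that every ordered cross pair of slots either has no common constituent, or is jointly onto in `U(Σ)` with every third slot foreign to one of
its two members.  This contains the slot criterion (`typeRank_sigmaType_add_card_eq_of_pairwise_slots_fiber`, first alternative throughout).
[cite: Gordon1999HodgeAVSurvey, §3 Theorem (1) (proof)] [cite: MoonenZarhin1999LowDim, §3 (3.1), Remark (3.9)] -/
theorem typeRank_sigmaType_add_card_eq_of_pairwise_or_jointly_onto_fiber {ρ : G} {Φ : ∀ i, Set (E i)} (h : ∀ i, IsCMTypeWith ρ (Φ i))
    (κ : I → C) (hκ : Function.Surjective κ)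
    (hyp : ∀ i j, κ i ≠ κ j →
      (∀ P : Submodule ℚ (E i → ℚ), P ≤ antiSpan G (Φ i) → (∀ g : G, ∀ f ∈ P, (fun x => f (g • x)) ∈ P) →
        ∀ T : (E i → ℚ) →ₗ[ℚ] (E j → ℚ), (∀ g : G, ∀ f ∈ P, T (fun x => f (g • x)) = fun y => T f (g • y)) →
          (∀ f ∈ P, T f ∈ antiSpan G (Φ j)) → (∀ f ∈ P, T f = 0 → f = 0) → P = ⊥) ∨
      ((∀ a ∈ antiSpan G (Φ i), ∀ b ∈ antiSpan G (Φ j), ∃ m ∈ antiSpan G (sigmaType Φ),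
          LinearMap.funLeft ℚ ℚ (Sigma.mk i) m = a ∧ LinearMap.funLeft ℚ ℚ (Sigma.mk j) m = b) ∧
        ∀ l, l ≠ i → l ≠ j →
          (∀ P : Submodule ℚ (E i → ℚ), P ≤ antiSpan G (Φ i) → (∀ g : G, ∀ f ∈ P, (fun x => f (g • x)) ∈ P) →
            ∀ T : (E i → ℚ) →ₗ[ℚ] (E l → ℚ), (∀ g : G, ∀ f ∈ P, T (fun x => f (g • x)) = fun y => T f (g • y)) →
              (∀ f ∈ P, T f ∈ antiSpan G (Φ l)) → (∀ f ∈ P, T f = 0 → f = 0) → P = ⊥) ∨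
          (∀ P : Submodule ℚ (E j → ℚ), P ≤ antiSpan G (Φ j) → (∀ g : G, ∀ f ∈ P, (fun x => f (g • x)) ∈ P) →
            ∀ T : (E j → ℚ) →ₗ[ℚ] (E l → ℚ), (∀ g : G, ∀ f ∈ P, T (fun x => f (g • x)) = fun y => T f (g • y)) →
              (∀ f ∈ P, T f ∈ antiSpan G (Φ l)) → (∀ f ∈ P, T f = 0 → f = 0) → P = ⊥))) :
    typeRank G (sigmaType Φ) + Fintype.card C = (∑ c, typeRank G (sigmaType fun i : {i // κ i = c} => Φ i.1)) + 1 := by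
  classical
  haveI : Nonempty C := ⟨κ (Classical.arbitrary I)⟩
  haveI hne : ∀ c, Nonempty (Σ i : {i // κ i = c}, E i.1) := fun c => by
    obtain ⟨i, hi⟩ := hκ c
    exact ⟨⟨⟨i, hi⟩, Classical.arbitrary (E i)⟩⟩
  have hΨ : ∀ c, IsCMTypeWith ρ (sigmaType fun i : {i // κ i = c} => Φ i.1) := fun c => isCMTypeWith_sigmaType_fiber h κ c
  haveI : Nonempty (Σ c, Σ i : {i // κ i = c}, E i.1) := ⟨⟨Classical.arbitrary C, Classical.arbitrary _⟩⟩
  rw [← typeRank_sigmaType_fiber Φ κ, (IsCMTypeWith.sigmaType hΨ).typeRank_eq_finrank_antiSpan_add_one,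
    Finset.sum_congr rfl fun c _ => (hΨ c).typeRank_eq_finrank_antiSpan_add_one, Finset.sum_add_distrib, Finset.sum_const, Finset.card_univ,
    smul_eq_mul, mul_one, finrank_antiSpan_sigmaType_fiber_eq_of_pairwise_or_jointly_onto κ hyp]
  omega

end Core

end Summit.HodgeConjecture.CorCM.MultiFieldWeil

end
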